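import Summits.RiemannHypothesis.RiemannHypothesis.Theorems.SignConeEnvelopeCutoff
import Literature.NumberTheory.LFunctions.WeilFirstPrimeQuadratic

/-!
# The sign-cone inequality at a finite cutoff from ONE fake weight, and from the first-prime form
(route `SignCone`, item stmt-RiemannHypothesis-16302 `SignConeOscillatory`; the easy direction of `SignConeDuality`)

On the sign cone (node-nonnegative `F = Σᵢ gᵢ ⋆ g̃ᵢ`) every fake prime term
`P_c(F) = Σₙ c(n) n^{-1/2} (F(log n) + F(-log n))` with `c ≥ 0` has `Re P_c(F) ≥ 0`. Consequently, at a fixed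
cutoff `b`, the EXACT sign-cone inequality `0 ≤ Re W_ar(F)` (`W_ar = weilPolarTerm + weilArchTerm`) follows from
the positivity of a single fake Weil form on the Weil cone:

* `re_weilArchPolar_nonneg_of_fakeWeight` — if some `c ≥ 0` has `Re (W_ar(g ⋆ g̃) - P_c(g ⋆ g̃)) ≥ 0` for every
  Weil test `g` supported in `[-b, b]`, then `0 ≤ Re W_ar(F)` for every node-nonnegative `F = Σᵢ gᵢ ⋆ g̃ᵢ` with
  `tsupport gᵢ ⊆ [-b, b]` (the converse, at each cutoff, is the route's crux `SignConeDuality`);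
* `re_weilArchPolar_eq_sum_weilFirstPrimeQuadratic_add` — the support-free identity
  `Re W_ar(F) = Σᵢ E₂(gᵢ) + √2 log 2 · Re F(log 2)` with `E₂ = weilFirstPrimeQuadratic` the first-prime analytic form
  (`w₂(t) = Re ψ(1/4 + it/2) - √2 log 2 cos(t log 2)`; Mellin inversion makes the prime `2` diagonal in frequency);
* `re_weilArchPolar_nonneg_of_weilFirstPrimeQuadratic_nonneg` — hence `E₂ ≥ 0` on `C(b)` gives the exact sign-cone
  inequality at cutoff `b`, using ONLY the sign of `Re F(log 2)`; and the route statements restricted to `a ≤ b`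
  (`signConeExact_upTo_of_weilFirstPrimeQuadratic_nonneg`, `signConeOscillatory_upTo_of_weilFirstPrimeQuadratic_nonneg`).

The tree certifies `E₂ ≥ 0` on `C((log 3)/2)` (`WeilFirstPrimePositivityC.lean`), which recovers the unconditional rung
of `SignConeEnvelopeCutoff.lean`; any certificate of `E₂ ≥ 0` on `C(b)` for a larger `b` (the `WeilCert2/3` format allows
`b ≤ a₀ ≤ 1`) extends the unconditional range of item stmt-RiemannHypothesis-16302 to `a ≤ b` at once. NB `E₂ ≥ 0` on
`C(b)` must fail for large `b` (for `b > (log 3)/2` it is not Weil positivity: `E₂(g) = Re Q(g) + Σ_{n ≥ 3} Λ(n) n^{-1/2}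
2 Re G(log n)`), so this is a device for finite cutoffs only.
-/

noncomputable section

-- `Summit.RiemannHypothesis.RiemannHypothesis.…` repeats a namespace component by design (D-0017 layout).
set_option linter.dupNamespace false

open scoped BigOperators ComplexConjugate ArithmeticFunction.vonMangoldt Real
open Complex MeasureTheory Set Filter

namespace Summit.RiemannHypothesis.RiemannHypothesis.Theorems.SignCone

open Literature.NumberTheory.LFunctions
open Summit.RiemannHypothesis.RiemannHypothesis.Theorems.RuelleBandCofiniteCriticalLine

/-! ## Fake prime terms `P_c(F) = Σₙ c(n) n^{-1/2} (F(log n) + F(-log n))` -/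

/-- For compactly supported `F` the fake prime series has finite support, hence is summable (any weight `c`).
[folklore] -/
theorem summable_fakePrimeTerm (c : ℕ → ℝ) {F : ℝ → ℂ} (hF : HasCompactSupport F) :
    Summable fun n : ℕ => ((c n : ℝ) : ℂ) / (Real.sqrt n : ℂ) * (F (Real.log n) + F (-Real.log n)) := by
  -- adapted from `summable_weilPrimeTerm`
  obtain ⟨R, hR⟩ := hF.isCompact.isBounded.subset_closedBall 0
  refine summable_of_ne_finset_zero (s := Finset.range ⌈Real.exp (|R| + 1)⌉₊) fun n hn => ?_
  rw [Finset.mem_range, not_lt] at hn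
  have hn' : Real.exp (|R| + 1) ≤ n := (Nat.le_ceil _).trans (by exact_mod_cast hn)
  have hpos : (0 : ℝ) < n := (Real.exp_pos _).trans_le hn'
  have hlog : |R| + 1 ≤ Real.log n := by rwa [Real.le_log_iff_exp_le hpos]
  have h0 : ∀ x : ℝ, |R| < |x| → F x = 0 := fun x hx =>
    image_eq_zero_of_notMem_tsupport fun hxs => by
      have hxR := hR hxs
      rw [Metric.mem_closedBall, dist_zero_right, Real.norm_eq_abs] at hxR
      linarith [le_abs_self R]
  have h1 : |R| < |Real.log n| := lt_of_lt_of_le (by linarith) (le_abs_self _)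
  rw [h0 _ h1, h0 _ (by rwa [abs_neg]), add_zero, mul_zero]

/-- On a hermitian kernel with `Re F(0) ≥ 0` and `Re F(log n) ≥ 0` (`n ≥ 2`), every fake prime term with
non-negative weight has non-negative real part. [folklore] -/
theorem re_fakePrimeTerm_nonneg {c : ℕ → ℝ} (hc : ∀ n, 0 ≤ c n) {F : ℝ → ℂ} (hFc : HasCompactSupport F)
    (hsym : ∀ t : ℝ, conj (F (-t)) = F t) (h0 : 0 ≤ (F 0).re)
    (hn : ∀ n : ℕ, 2 ≤ n → 0 ≤ (F (Real.log n)).re) :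
    0 ≤ (∑' n : ℕ, ((c n : ℝ) : ℂ) / (Real.sqrt n : ℂ) * (F (Real.log n) + F (-Real.log n))).re := by
  rw [Complex.re_tsum (summable_fakePrimeTerm c hFc)]
  refine tsum_nonneg fun n => ?_
  have hcoef : ((c n : ℝ) : ℂ) / (Real.sqrt n : ℂ) = ((c n / Real.sqrt n : ℝ) : ℂ) := by
    push_cast
    rfl
  have hre' : (F (-Real.log n)).re = (F (Real.log n)).re := by
    have h := congrArg Complex.re (hsym (Real.log n))
    simpa only [Complex.conj_re] using h
  have hre : (F (Real.log n) + F (-Real.log n)).re = 2 * (F (Real.log n)).re := by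
    rw [Complex.add_re, hre']
    ring
  have hnode : 0 ≤ (F (Real.log n)).re := by
    rcases lt_or_ge n 2 with hn2 | hn2
    · interval_cases n <;> simpa using h0
    · exact hn n hn2
  rw [hcoef, Complex.re_ofReal_mul, hre]
  exact mul_nonneg (div_nonneg (hc n) (Real.sqrt_nonneg _)) (by nlinarith)

/-- Fake prime terms are additive over finite sums of compactly supported kernels. [folklore] -/
theorem fakePrimeTerm_finset_sum (c : ℕ → ℝ) {ι : Type*} (s : Finset ι) {G : ι → ℝ → ℂ}
    (hG : ∀ i ∈ s, HasCompactSupport (G i)) :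
    (∑' n : ℕ, ((c n : ℝ) : ℂ) / (Real.sqrt n : ℂ) *
        ((∑ i ∈ s, G i (Real.log n)) + ∑ i ∈ s, G i (-Real.log n))) =
      ∑ i ∈ s, ∑' n : ℕ, ((c n : ℝ) : ℂ) / (Real.sqrt n : ℂ) * (G i (Real.log n) + G i (-Real.log n)) := by
  rw [← Summable.tsum_finsetSum fun i hi => summable_fakePrimeTerm c (hG i hi)]
  refine tsum_congr fun n => ?_
  rw [← Finset.sum_add_distrib, Finset.mul_sum]

/-! ## `W_ar` over finite sums -/

/-- `W_ar = W + P_Λ` is additive over finite sums of Weil test kernels. [folklore] -/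
theorem weilArchPolar_finset_sum {ι : Type*} (s : Finset ι) {G : ι → ℝ → ℂ}
    (hG : ∀ i ∈ s, IsWeilTest (G i)) :
    weilPolarTerm (fun t => ∑ i ∈ s, G i t) + weilArchTerm (fun t => ∑ i ∈ s, G i t) =
      ∑ i ∈ s, (weilPolarTerm (G i) + weilArchTerm (G i)) := by
  have hW := stub_branchesContinuous_weilFunctional_sum s hG
  have hP : weilPrimeTerm (fun t => ∑ i ∈ s, G i t) = ∑ i ∈ s, weilPrimeTerm (G i) := by
    unfold weilPrimeTerm
    exact fakePrimeTerm_finset_sum (fun n => Λ n) s fun i hi => (hG i hi).2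
  have hdec : ∀ K : ℝ → ℂ, weilPolarTerm K + weilArchTerm K = weilFunctional K + weilPrimeTerm K := by
    intro K
    unfold weilFunctional
    ring
  rw [hdec, hW, hP, ← Finset.sum_add_distrib]
  exact Finset.sum_congr rfl fun i _ => (hdec (G i)).symm

/-! ## One fake weight gives the sign-cone inequality at a finite cutoff -/

/-- **Easy direction of `SignConeDuality` (with zero slack).** If a non-negative weight `c` makes the fake Weil form
`W_ar - P_c` non-negative on the Weil tests supported in `[-b, b]`, then the exact sign-cone inequality
`0 ≤ Re W_ar(F)` holds for every node-nonnegative `F = Σᵢ gᵢ ⋆ g̃ᵢ` at cutoff `b`. [folklore] -/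
theorem re_weilArchPolar_nonneg_of_fakeWeight {b : ℝ} {c : ℕ → ℝ} (hc : ∀ n, 0 ≤ c n)
    (hW : ∀ g : ℝ → ℂ, IsWeilTest g → tsupport g ⊆ Icc (-b) b →
      0 ≤ (weilPolarTerm (weilConv g (weilReflect g)) + weilArchTerm (weilConv g (weilReflect g)) -
        ∑' n : ℕ, ((c n : ℝ) : ℂ) / (Real.sqrt n : ℂ) *
          (weilConv g (weilReflect g) (Real.log n) + weilConv g (weilReflect g) (-Real.log n))).re)
    {k : ℕ} {g : Fin k → ℝ → ℂ} {F : ℝ → ℂ} (hF : F = fun t => ∑ i, weilConv (g i) (weilReflect (g i)) t)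
    (hg : ∀ i, IsWeilTest (g i)) (hsupp : ∀ i, tsupport (g i) ⊆ Icc (-b) b)
    (hn : ∀ n : ℕ, 2 ≤ n → 0 ≤ (F (Real.log n)).re) :
    0 ≤ (weilPolarTerm F + weilArchTerm F).re := by
  have hGi : ∀ i, IsWeilTest (weilConv (g i) (weilReflect (g i))) := fun i =>
    (hg i).weilConv (hg i).weilReflect
  have hFt : IsWeilTest F := by
    rw [hF]
    exact stub_branchesContinuous_isWeilTest_sum _ fun i _ => hGi i
  have hsym : ∀ t : ℝ, conj (F (-t)) = F t := by
    intro t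
    simp only [hF, map_sum, conj_weilConv_weilReflect_neg]
  have h0 : 0 ≤ (F 0).re := re_apply_zero_nonneg hF
  -- `W_ar(F) = Σᵢ W_ar(Gᵢ)` and `P_c(F) = Σᵢ P_c(Gᵢ)`
  have hA : weilPolarTerm F + weilArchTerm F =
      ∑ i, (weilPolarTerm (weilConv (g i) (weilReflect (g i))) +
        weilArchTerm (weilConv (g i) (weilReflect (g i)))) := by
    rw [hF]
    exact weilArchPolar_finset_sum _ fun i _ => hGi i
  have hPc : (∑' n : ℕ, ((c n : ℝ) : ℂ) / (Real.sqrt n : ℂ) * (F (Real.log n) + F (-Real.log n))) =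
      ∑ i, ∑' n : ℕ, ((c n : ℝ) : ℂ) / (Real.sqrt n : ℂ) *
        (weilConv (g i) (weilReflect (g i)) (Real.log n) +
          weilConv (g i) (weilReflect (g i)) (-Real.log n)) := by
    rw [← fakePrimeTerm_finset_sum c _ fun i _ => (hGi i).2]
    simp only [hF]
  have hPre := re_fakePrimeTerm_nonneg hc hFt.2 hsym h0 hn
  have hsum : 0 ≤ ∑ i, ((weilPolarTerm (weilConv (g i) (weilReflect (g i))) +
      weilArchTerm (weilConv (g i) (weilReflect (g i)))) -
        ∑' n : ℕ, ((c n : ℝ) : ℂ) / (Real.sqrt n : ℂ) *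
          (weilConv (g i) (weilReflect (g i)) (Real.log n) +
            weilConv (g i) (weilReflect (g i)) (-Real.log n))).re :=
    Finset.sum_nonneg fun i _ => hW _ (hg i) (hsupp i)
  have key : (weilPolarTerm F + weilArchTerm F).re =
      (∑ i, ((weilPolarTerm (weilConv (g i) (weilReflect (g i))) +
        weilArchTerm (weilConv (g i) (weilReflect (g i)))) -
          ∑' n : ℕ, ((c n : ℝ) : ℂ) / (Real.sqrt n : ℂ) *
            (weilConv (g i) (weilReflect (g i)) (Real.log n) +
              weilConv (g i) (weilReflect (g i)) (-Real.log n))).re) +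
        (∑' n : ℕ, ((c n : ℝ) : ℂ) / (Real.sqrt n : ℂ) * (F (Real.log n) + F (-Real.log n))).re := by
    rw [hA, hPc, ← Complex.re_sum, ← Complex.add_re, Finset.sum_sub_distrib, sub_add_cancel]
  rw [key]
  exact add_nonneg hsum hPre

/-! ## The first-prime analytic form governs `W_ar` -/

/-- **`W_ar` of an autocorrelation in first-prime analytic form (no support hypothesis).** For every Weil test `g`,
`W_ar(g ⋆ g̃) = E₂(g) + (log 2/√2)((g ⋆ g̃)(log 2) + (g ⋆ g̃)(-log 2))` as complex numbers, where
`E₂ = weilFirstPrimeQuadratic` (Mellin inversion on the critical line makes the node `log 2` diagonal in frequency,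
`weilConv_weilReflect_log_two_add`). [folklore] -/
theorem weilArchPolar_weilConv_weilReflect_eq {g : ℝ → ℂ} (hg : IsWeilTest g) :
    weilPolarTerm (weilConv g (weilReflect g)) + weilArchTerm (weilConv g (weilReflect g)) =
      (weilFirstPrimeQuadratic g : ℂ) + ((Real.log 2 : ℝ) : ℂ) / (Real.sqrt 2 : ℂ) *
        (weilConv g (weilReflect g) (Real.log 2) + weilConv g (weilReflect g) (-Real.log 2)) := by
  -- adapted from `weilQuadratic_eq_weilFirstPrimeQuadratic` (the prime-term step removed)
  have hpi : (2 * π : ℂ) ≠ 0 := by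
    have : (0 : ℝ) < 2 * π := by positivity
    exact_mod_cast this.ne'
  have hprime : weilConv g (weilReflect g) (Real.log 2) + weilConv g (weilReflect g) (-Real.log 2) =
      (1 / (2 * π) : ℂ) *
        ((∫ t : ℝ, ‖weilMellin g (1 / 2 + t * I)‖ ^ 2 * (2 * Real.cos (t * Real.log 2)) : ℝ) : ℂ) := by
    rw [← weilConv_weilReflect_log_two_add hg]
    field_simp
  have hI1 := integrable_norm_sq_weilMellin_mul_reDigammaQuarter hg
  have hI2 : Integrable fun t : ℝ =>
      ‖weilMellin g (1 / 2 + t * I)‖ ^ 2 * (2 * Real.cos (t * Real.log 2)) :=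
    integrable_norm_sq_weilMellin_mul hg (by fun_prop) (A := 2) (B := 0) (by norm_num) le_rfl
      fun t => by
        rw [zero_mul, add_zero, abs_mul, abs_two]
        exact mul_le_of_le_one_right (by norm_num) (Real.abs_cos_le_one _)
  have hsplit : ∫ t : ℝ, ‖weilMellin g (1 / 2 + t * I)‖ ^ 2 * weilFirstPrimeWeight t =
      (∫ t : ℝ, ‖weilMellin g (1 / 2 + t * I)‖ ^ 2 *
          Literature.Analysis.SpecialFunctions.reDigammaQuarter t) -
        Real.sqrt 2 * Real.log 2 / 2 *
          ∫ t : ℝ, ‖weilMellin g (1 / 2 + t * I)‖ ^ 2 * (2 * Real.cos (t * Real.log 2)) := by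
    rw [← integral_const_mul, ← integral_sub hI1 (hI2.const_mul _)]
    congr 1 with t
    unfold weilFirstPrimeWeight
    ring
  have hsqrt : Real.log 2 / Real.sqrt 2 = Real.sqrt 2 * Real.log 2 / 2 := by
    have h2 : Real.sqrt 2 * Real.sqrt 2 = 2 := Real.mul_self_sqrt (by norm_num)
    have hs : Real.sqrt 2 ≠ 0 := by positivity
    field_simp
    nlinarith [h2]
  have hcoef : ((Real.log 2 : ℝ) : ℂ) / (Real.sqrt 2 : ℂ) = ((Real.sqrt 2 * Real.log 2 / 2 : ℝ) : ℂ) := by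
    rw [← hsqrt]
    push_cast
    ring
  -- name the real atoms so that no normalisation happens under binders
  set Aψ : ℝ := ∫ t : ℝ, ‖weilMellin g (1 / 2 + t * I)‖ ^ 2 *
    Literature.Analysis.SpecialFunctions.reDigammaQuarter t with hAψ
  set Ac : ℝ := ∫ t : ℝ, ‖weilMellin g (1 / 2 + t * I)‖ ^ 2 * (2 * Real.cos (t * Real.log 2)) with hAc
  have hA : weilArchIntegral (weilConv g (weilReflect g)) = (Aψ : ℂ) :=
    weilArchIntegral_weilConv_weilReflect hg
  have hE : weilFirstPrimeQuadratic g = 2 * (weilMellin g 0 * conj (weilMellin g 1)).re -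
      Real.log π * weilNorm2Sq g + 1 / (2 * π) * (Aψ - Real.sqrt 2 * Real.log 2 / 2 * Ac) := by
    unfold weilFirstPrimeQuadratic
    rw [hsplit]
  unfold weilArchTerm
  rw [hA, weilPolarTerm_weilConv_weilReflect hg, weilConv_weilReflect_apply_zero, hprime, hE, hcoef]
  unfold weilNorm2Sq
  push_cast
  ring

/-- **`Re W_ar(F) = Σᵢ E₂(gᵢ) + √2 log 2 · Re F(log 2)`** for a finite sum of autocorrelations `F = Σᵢ gᵢ ⋆ g̃ᵢ`
(no support hypothesis). [folklore] -/
theorem re_weilArchPolar_eq_sum_weilFirstPrimeQuadratic_add {k : ℕ} {g : Fin k → ℝ → ℂ} {F : ℝ → ℂ}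
    (hF : F = fun t => ∑ i, weilConv (g i) (weilReflect (g i)) t) (hg : ∀ i, IsWeilTest (g i)) :
    (weilPolarTerm F + weilArchTerm F).re =
      ∑ i, weilFirstPrimeQuadratic (g i) + Real.sqrt 2 * Real.log 2 * (F (Real.log 2)).re := by
  have hGi : ∀ i, IsWeilTest (weilConv (g i) (weilReflect (g i))) := fun i =>
    (hg i).weilConv (hg i).weilReflect
  have hA : weilPolarTerm F + weilArchTerm F =
      ∑ i, (weilPolarTerm (weilConv (g i) (weilReflect (g i))) +
        weilArchTerm (weilConv (g i) (weilReflect (g i)))) := by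
    rw [hF]
    exact weilArchPolar_finset_sum _ fun i _ => hGi i
  have hsym : ∀ t : ℝ, conj (F (-t)) = F t := by
    intro t
    simp only [hF, map_sum, conj_weilConv_weilReflect_neg]
  have hre' : (F (-Real.log 2)).re = (F (Real.log 2)).re := by
    have h := congrArg Complex.re (hsym (Real.log 2))
    simpa only [Complex.conj_re] using h
  have hF2 : (∑ i, (weilConv (g i) (weilReflect (g i)) (Real.log 2) +
      weilConv (g i) (weilReflect (g i)) (-Real.log 2))) = F (Real.log 2) + F (-Real.log 2) := by
    rw [Finset.sum_add_distrib]
    simp only [hF]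
  have hcoef : ((Real.log 2 : ℝ) : ℂ) / (Real.sqrt 2 : ℂ) = ((Real.log 2 / Real.sqrt 2 : ℝ) : ℂ) := by
    push_cast
    rfl
  have hsqrt : Real.log 2 / Real.sqrt 2 * 2 = Real.sqrt 2 * Real.log 2 := by
    have h2 : Real.sqrt 2 * Real.sqrt 2 = 2 := Real.mul_self_sqrt (by norm_num)
    have hs : Real.sqrt 2 ≠ 0 := by positivity
    field_simp
    nlinarith [h2]
  rw [hA, Finset.sum_congr rfl fun i _ => weilArchPolar_weilConv_weilReflect_eq (hg i),
    Finset.sum_add_distrib, ← Finset.mul_sum, hF2, Complex.add_re, Complex.re_sum, hcoef,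
    Complex.re_ofReal_mul, Complex.add_re, hre', ← hsqrt]
  simp only [Complex.ofReal_re]
  ring

/-- **`E₂ ≥ 0` on `C(b)` gives the exact sign-cone inequality at cutoff `b`, using only the node `log 2`.** If
`0 ≤ E₂(g)` for every Weil test `g` supported in `[-b, b]`, then `0 ≤ Re W_ar(F)` for every `F = Σᵢ gᵢ ⋆ g̃ᵢ` with
`tsupport gᵢ ⊆ [-b, b]` and `Re F(log 2) ≥ 0`. [folklore] -/
theorem re_weilArchPolar_nonneg_of_weilFirstPrimeQuadratic_nonneg {b : ℝ}
    (hE : ∀ g : ℝ → ℂ, IsWeilTest g → tsupport g ⊆ Icc (-b) b → 0 ≤ weilFirstPrimeQuadratic g)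
    {k : ℕ} {g : Fin k → ℝ → ℂ} {F : ℝ → ℂ} (hF : F = fun t => ∑ i, weilConv (g i) (weilReflect (g i)) t)
    (hg : ∀ i, IsWeilTest (g i)) (hsupp : ∀ i, tsupport (g i) ⊆ Icc (-b) b)
    (h2 : 0 ≤ (F (Real.log 2)).re) : 0 ≤ (weilPolarTerm F + weilArchTerm F).re := by
  rw [re_weilArchPolar_eq_sum_weilFirstPrimeQuadratic_add hF hg]
  exact add_nonneg (Finset.sum_nonneg fun i _ => hE _ (hg i) (hsupp i)) (by positivity)

/-- The rung recovered: `E₂ ≥ 0` on `C((log 3)/2)` is certified in the tree, so the exact sign-cone inequality holds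
at every cutoff `a ≤ (log 3)/2` using only `Re F(log 2) ≥ 0` (compare `re_weilArchPolar_nonneg_of_le_log_three_half`,
which goes through Weil positivity and uses all nodes). [folklore] -/
theorem re_weilArchPolar_nonneg_of_le_log_three_half' {a : ℝ} (ha : a ≤ Real.log 3 / 2) {k : ℕ}
    {g : Fin k → ℝ → ℂ} {F : ℝ → ℂ} (hF : F = fun t => ∑ i, weilConv (g i) (weilReflect (g i)) t)
    (hg : ∀ i, IsWeilTest (g i)) (hsupp : ∀ i, tsupport (g i) ⊆ Icc (-a) a)
    (h2 : 0 ≤ (F (Real.log 2)).re) : 0 ≤ (weilPolarTerm F + weilArchTerm F).re :=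
  re_weilArchPolar_nonneg_of_weilFirstPrimeQuadratic_nonneg (b := a)
    (fun _ hg' hs' => weilFirstPrimeQuadratic_nonneg_of_tsupport_subset_log_three_half hg'
      (hs'.trans (Icc_subset_Icc (neg_le_neg ha) ha)))
    hF hg hsupp h2

/-! ## The route statements at cutoffs where `E₂ ≥ 0` is known -/

/-- **The exact sign-cone inequality up to any cutoff `b` with `E₂ ≥ 0` on `C(b)`** — the statement of the route item
`SignConeUpTo210` with `(log 210)/2` replaced by `b`, conditional on first-prime-form positivity on `C(b)` (body
verbatim over Mathlib primitives). [folklore] -/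
theorem signConeExact_upTo_of_weilFirstPrimeQuadratic_nonneg {b : ℝ}
    (hE : ∀ g : ℝ → ℂ, IsWeilTest g → tsupport g ⊆ Icc (-b) b → 0 ≤ weilFirstPrimeQuadratic g) :
    ∀ a : ℝ, 0 < a → a ≤ b → ∀ (k : ℕ) (g : Fin k → ℝ → ℂ), (∀ i, (ContDiff ℝ ((⊤ : ℕ∞) : WithTop ℕ∞) (g i) ∧ HasCompactSupport (g i)) ∧ tsupport (g i) ⊆ Set.Icc (-a) a) → let F : ℝ → ℂ := fun t => ∑ i, MeasureTheory.convolution (g i) (fun u => (starRingEnd ℂ) ((g i) (-u))) (ContinuousLinearMap.mul ℂ ℂ) MeasureTheory.MeasureSpace.volume t; (∀ n : ℕ, 2 ≤ n → 0 ≤ (F (Real.log n)).re) → let M : ℂ → ℂ := fun s => ∫ u : ℝ, F u * Complex.exp ((s - 1 / 2) * u); 0 ≤ (M 0 + M 1 + ((1 / (2 * Real.pi) : ℂ) * (∫ t : ℝ, M (1 / 2 + t * Complex.I) * ((Complex.digamma (1 / 4 + t / 2 * Complex.I)).re : ℂ)) - F 0 * (Real.log Real.pi : ℂ))).re := by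
  intro a _ha hab k g hg F hn M
  exact re_weilArchPolar_nonneg_of_weilFirstPrimeQuadratic_nonneg (b := b) hE (g := g) (F := F) rfl
    (fun i => (hg i).1) (fun i => (hg i).2.trans (Icc_subset_Icc (neg_le_neg hab) hab)) (hn 2 le_rfl)

/-- **`SignConeOscillatory` up to any cutoff `b` with `E₂ ≥ 0` on `C(b)`** — the statement of the route item
`SignConeOscillatory` (stmt-RiemannHypothesis-16302) with the extra hypothesis `a ≤ b`, conditional on first-prime-form
positivity on `C(b)`; with `b = (log 3)/2` this is unconditional (`signConeOscillatory_upTo_log_three_half`). [folklore] -/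
theorem signConeOscillatory_upTo_of_weilFirstPrimeQuadratic_nonneg {b : ℝ}
    (hE : ∀ g : ℝ → ℂ, IsWeilTest g → tsupport g ⊆ Icc (-b) b → 0 ≤ weilFirstPrimeQuadratic g) :
    ∀ a : ℝ, 0 < a → a ≤ b → ∀ (k : ℕ) (g : Fin k → ℝ → ℂ), (∀ i, (ContDiff ℝ ((⊤ : ℕ∞) : WithTop ℕ∞) (g i) ∧ HasCompactSupport (g i)) ∧ tsupport (g i) ⊆ Set.Icc (-a) a) → let F : ℝ → ℂ := fun t => ∑ i, MeasureTheory.convolution (g i) (fun u => (starRingEnd ℂ) ((g i) (-u))) (ContinuousLinearMap.mul ℂ ℂ) MeasureTheory.MeasureSpace.volume t; (∀ n : ℕ, 2 ≤ n → 0 ≤ (F (Real.log n)).re) → (∃ t : ℝ, Real.log 2 ≤ |t| ∧ (F t).re < 0) → let M : ℂ → ℂ := fun s => ∫ u : ℝ, F u * Complex.exp ((s - 1 / 2) * u); -(F 0).re ≤ (M 0 + M 1 + ((1 / (2 * Real.pi) : ℂ) * (∫ t : ℝ, M (1 / 2 + t * Complex.I) * ((Complex.digamma (1 / 4 + t / 2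 * Complex.I)).re : ℂ)) - F 0 * (Real.log Real.pi : ℂ))).re := by
  intro a _ha hab k g hg F hn _hosc M
  have h1 := re_weilArchPolar_nonneg_of_weilFirstPrimeQuadratic_nonneg (b := b) hE (g := g) (F := F) rfl
    (fun i => (hg i).1) (fun i => (hg i).2.trans (Icc_subset_Icc (neg_le_neg hab) hab)) (hn 2 le_rfl)
  have h0 := re_apply_zero_nonneg (g := g) (F := F) rfl
  have h : -(F 0).re ≤ (weilPolarTerm F + weilArchTerm F).re := by linarith
  exact h

/-! ## The certified cutoff `563/1024`

The Stage-C certificate `weilCert3C` of the tree certifies `E₂ ≥ 0` on `C(563/1024)`, and `563/1024 = 0.5498… >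
(log 3)/2 = 0.5493…` (`log_three_half_le_certb`). Through `re_weilArchPolar_nonneg_of_weilFirstPrimeQuadratic_nonneg`
this certifies the sign-cone statements at every cutoff `a ≤ 563/1024` — marginally, but strictly, BEYOND the range
`a ≤ (log 3)/2` on which Weil positivity itself is known in the tree (for `a > (log 3)/2`, `E₂ ≠ Re Q`). -/

/-- `weilCert3C.b = 563/1024`. [folklore] -/
theorem weilCert3C_b : weilCert3C.b = 563 / 1024 := rfl

/-- `E₂ ≥ 0` on `C(563/1024)` (the kernel-checked Stage-C certificate, at its own support parameter). [folklore] -/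
theorem weilFirstPrimeQuadratic_nonneg_of_tsupport_subset_certb {g : ℝ → ℂ} (hg : IsWeilTest g)
    (hsupp : tsupport g ⊆ Icc (-(563 / 1024 : ℝ)) (563 / 1024)) : 0 ≤ weilFirstPrimeQuadratic g := by
  have e : ((weilCert3C.b : ℚ) : ℝ) = 563 / 1024 := by
    rw [weilCert3C_b]
    push_cast
    norm_num
  have hb : tsupport g ⊆ Icc (-((weilCert3C.b : ℚ) : ℝ)) ((weilCert3C.b : ℚ) : ℝ) := by
    rw [e]
    exact hsupp
  have h := WeilCert3.weilFirstPrimeQuadratic_nonneg_of_check check_weilCert3C hg hb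
  unfold weilFirstPrimeQuadratic weilFirstPrimeWeight
  exact h

/-- **The exact sign-cone inequality up to the certified cutoff `563/1024`** (unconditional). [folklore] -/
theorem signConeExact_upTo_certb :
    ∀ a : ℝ, 0 < a → a ≤ 563 / 1024 → ∀ (k : ℕ) (g : Fin k → ℝ → ℂ), (∀ i, (ContDiff ℝ ((⊤ : ℕ∞) : WithTop ℕ∞) (g i) ∧ HasCompactSupport (g i)) ∧ tsupport (g i) ⊆ Set.Icc (-a) a) → let F : ℝ → ℂ := fun t => ∑ i, MeasureTheory.convolution (g i) (fun u => (starRingEnd ℂ) ((g i) (-u))) (ContinuousLinearMap.mul ℂ ℂ) MeasureTheory.MeasureSpace.volume t; (∀ n : ℕ, 2 ≤ n → 0 ≤ (F (Real.log n)).re) → let M : ℂ → ℂ := fun s => ∫ u : ℝ, F u * Complex.exp ((s - 1 / 2) * u); 0 ≤ (M 0 + M 1 + ((1 / (2 * Real.pi) : ℂ) * (∫ t : ℝ, M (1 / 2 + t * Complex.I) * ((Complex.digamma (1 / 4 + t / 2 * Complex.I)).re : ℂ)) - F 0 * (Real.log Real.pi : ℂ))).re :=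
  signConeExact_upTo_of_weilFirstPrimeQuadratic_nonneg (b := 563 / 1024)
    fun _ hg hs => weilFirstPrimeQuadratic_nonneg_of_tsupport_subset_certb hg hs

/-- **`SignConeOscillatory` up to the certified cutoff `563/1024`** (unconditional; item stmt-RiemannHypothesis-16302
restricted to `a ≤ 563/1024`, which contains the rung `a ≤ (log 3)/2`). [folklore] -/
theorem signConeOscillatory_upTo_certb :
    ∀ a : ℝ, 0 < a → a ≤ 563 / 1024 → ∀ (k : ℕ) (g : Fin k → ℝ → ℂ), (∀ i, (ContDiff ℝ ((⊤ : ℕ∞) : WithTop ℕ∞) (g i) ∧ HasCompactSupport (g i)) ∧ tsupport (g i) ⊆ Set.Icc (-a) a) → let F : ℝ → ℂ := fun t => ∑ i, MeasureTheory.convolution (g i) (fun u => (starRingEnd ℂ) ((g i) (-u))) (ContinuousLinearMap.mul ℂ ℂ) MeasureTheory.MeasureSpace.volume t; (∀ n : ℕ, 2 ≤ n → 0 ≤ (F (Real.log n)).re) → (∃ t : ℝ, Real.log 2 ≤ |t| ∧ (F t).re < 0) → let M : ℂ → ℂ := fun s => ∫ u : ℝ, F u * Complex.exp ((s - 1 /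 2) * u); -(F 0).re ≤ (M 0 + M 1 + ((1 / (2 * Real.pi) : ℂ) * (∫ t : ℝ, M (1 / 2 + t * Complex.I) * ((Complex.digamma (1 / 4 + t / 2 * Complex.I)).re : ℂ)) - F 0 * (Real.log Real.pi : ℂ))).re :=
  signConeOscillatory_upTo_of_weilFirstPrimeQuadratic_nonneg (b := 563 / 1024)
    fun _ hg hs => weilFirstPrimeQuadratic_nonneg_of_tsupport_subset_certb hg hs

/-- The certified cutoff exceeds `(log 3)/2`. [folklore] -/
theorem log_three_half_le_certb' : Real.log 3 / 2 ≤ (563 / 1024 : ℝ) := by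
  have h := log_three_half_le_certb
  rw [weilCert3C_b] at h
  push_cast at h
  linarith

end Summit.RiemannHypothesis.RiemannHypothesis.Theorems.SignCone

end
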